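import Summits.KontsevichZagierPeriods.KontsevichZagierPeriods.Theses.FurushoPentagon
import Literature.NumberTheory.Transcendental.DrinfeldAssociatorRegularisation
import Literature.NumberTheory.Transcendental.AssociatorsHexagonProofs
import Literature.NumberTheory.Transcendental.DrinfeldAssociatorProofs
import Literature.NumberTheory.Transcendental.AssociatorsProofs
import Literature.NumberTheory.Transcendental.AssociatorsEval
import Literature.NumberTheory.Transcendental.KZLogCalculusProofs

/-!
# `PentagonInKZ` (stmt-KontsevichZagierPeriods-11348) — line `logfree-gauge-corner-flatness`: skeleton

Crux `Summit.KontsevichZagierPeriods.KontsevichZagierPeriods.Theses.FurushoPentagon.PentagonInKZ`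
(realisation form of Drinfeld's pentagon for the rules associator).  LEAD's skeleton of the line
`logfree-gauge-corner-flatness` (idea card `Cruxes/PentagonInKZ/Ideas/logfree-gauge-corner-flatness.md`),
rebuilt from the stub signatures registered by the crux planner and RESHAPED (lead, reshape 2):
the planner's five half-edge factorisations are DERIVED here from two universal identities
(`stub_halfEdgeUniversal`, `stub_chartB`) and the group-likeness of the log-free transports
(`stub_groupLike` ← `stub_shuffleProduct`), by central shifts and the exponential law; the five
corner identities (`stub_logfreeCorners`) and the existence of the path families
(`stub_pathFamilies`) are kept verbatim.  The composition `PentagonInKZ_of` is sorry-free.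

## The atlas (fifteen one-variable path families, three distinct ones)

Every path `p : Fin 15` is a straight segment of the closed pentagon cell of `M₀,₅(ℝ)` read in a
chart in which the KZ connection pulls back to `Σ_{i : Fin 3} A_i dt/(t - s_p i)` with rational
pole positions `s_p = shift p : Fin 3 → ℝ` — `![0,1,2]` (paths 0,2,4,5,6,7,8,9,12,13,14),
`![0,1,-1]` (paths 1,3) or `![0,-1,2]` (paths 10,11) — run from the tangential base point at `t = 0`
to `t = bound p` (`1/2`, resp. `1` for paths 10, 11).  For a word `w` over `Fin 3` NOT ending in the
letter `0` (pole at `t = 0`) the iterated integral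
`∫_{bound p > t₀ > ⋯ > t_{n-1} > 0} ∏ dtᵢ/(tᵢ - s_p(wᵢ))` (leftmost letter outermost) converges
absolutely and is a rational KZ representation `I p w : KZ.IntegralRep w.length`
(`stub_pathFamilies`); the LOG-FREE transport of path `p` is the series
`P p W = ⟨χ ∘ [I p ·], regEnd₀ W⟩` (end-regularisation `log t ↦ 0` at the tangential base point,
`Shuffle.regEnd`; by the regularisation algebra the STANDARD tangential transport to `t = bound p`
is `P p · e^{[log (bound p)] A₀}`), and `M p = (P p)(A_p)` its image in `U𝔞₄ ⊗ R/(deg > N)` under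
the letter assignment `A_p = args p` (sums of `t_ij`; paths 5–14 use only two letters).

* paths `5,…,14`: the ten HALF-EDGES (vertex → edge midpoint), two per edge;
* paths `0,…,4`: the five LEGS (edge midpoint → centre `q = (½,½)`), each shared by the two
  corners adjacent to its edge.

Since all coefficients only read the CLASSES `χ[I p w]`, paths with the same chart data give the
same series: `P 5 = P 6 = P 7 = P 8 = P 9 = P 12 = P 13 = P 14` (=: `A`, and also `= P 0 = P 2 =
P 4` on two letters), `P 10 = P 11` (=: `B`), `P 1 = P 3` (=: `C`) (`P_eq_of_chart`).

## The stubs (registered; ≤ 7)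

* `stub_pathFamilies` [M] — the representations exist.
* `stub_shuffleProduct` [M] — shuffle = dissection for the path simplices, in `KZ.relations`.
* `stub_groupLike` [M] — hence every `P p` is group-like (end-regularisation is a shuffle
  homomorphism; `χ` is a ring map killing the relations).
* `stub_halfEdgeUniversal` [L] — `A(Y,X) e^{λY} Φ_χ(X,Y) = A(X,Y) e^{λX}`, `λ = [log ½]`:
  the class-level `Φ = G₁(½)⁻¹G₀(½)`.
* `stub_chartB` [M] — `B(X,W) = A(X,-X-W) e^{λX}` (the chart `s = τ/(1-τ)` of the edge
  `t₁₂—t₂₃`).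
* `stub_logfreeCorners` [XL, hardest; held by the lead] — the five corner identities
  `M0 M5 = M4 M6`, `M0 M7 = M1 M8`, `M2 M10 = M1 M9`, `M2 M11 = M3 M12`, `M4 M14 = M3 M13`.

## The composition (`PentagonInKZ_of`, sorry-free)

(i) the five half-edge factorisations `M7 e^{λc} Φ(a,c) = M5 e^{λa}`,
`M9 e^{λ(d+e)} Φ(a+b,d+e) = M8 e^{λ(a+b+c)}`, `M11 Φ(c,e) = M10`,
`M14 e^{λe} Φ(b+c,e) = M6 e^{λ(a+b+c)}`, `M12 e^{λ(c+d)} Φ(a,c+d) = M13 e^{λa}`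
(`a,…,e = t₀₁,t₀₂,t₁₂,t₁₃,t₂₃`) from the universal identity at
`(X,Y) = (a,c), (a+b,d+e), (c,e), (b+c,e), (a,c+d)`, the chart identity, and the CENTRAL SHIFTS
`A(X+z,Y) = A(X,Y)`, `A(X,Y+z) = A(X,Y)e^{λz}` (`z` commuting with `X, Y`; exponential law for the
group-like `A` with `A(0) = 0`, `A(1ᵏ) = λᵏ/k!`); (ii) Drinfeld's telescoping in the group of units
of `U𝔞₄ ⊗ R/(deg>N)`: all `M p` are units, `e^{λx}e^{λy} = e^{λ(x+y)}` for commuting weight-one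
`x, y`, the five central shifts `z₁ = t₀₁+t₀₂+t₁₂`, `z₂ = t₁₂`, `z₃ = t₁₂+t₁₃+t₂₃`, `z₄ = t₀₁`,
`z₅ = t₂₃` commute (infinitesimal braid relations) with the letters of the two half-edge transports
of edges 1,…,5, and both sides of the pentagon equal
`e^{-λ z₃} M12⁻¹ M3⁻¹ M4 M6 e^{λ z₁} e^{λ t₀₁}` [Drinfeld1991, §2], [Furusho2011, §2].
-/

noncomputable section

open Literature.NumberTheory.Transcendental

namespace Summit.KontsevichZagierPeriods.FurushoPentagon.PentagonInKZ

open Summit.KontsevichZagierPeriods.KontsevichZagierPeriods.Theses.FurushoPentagon (PentagonInKZ)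

/-! ## 1. The registered stubs -/

/-- **Stub `stub_pathFamilies`** [M]: the fifteen path families of absolutely convergent rational
iterated integrals exist as KZ representations (ℚ-semialgebraic open simplex `bound p > t₀ > ⋯ >
t_{n-1} > 0`, integrand `∏ᵢ 1/(tᵢ - s_p(wᵢ))`, absolutely integrable since the innermost letter is
not the pole at `0`). [folklore] -/
theorem stub_pathFamilies :
    ∃ I : (p : Fin 15) → (w : List (Fin 3)) → KZ.IntegralRep w.length, ∀ (p : Fin 15) (w : List (Fin 3)), w.getLast? ≠ some 0 → (I p w).domain = {t | (∀ i, 0 < t i ∧ t i < (![1/2, 1/2, 1/2, 1/2, 1/2, 1/2, 1/2, 1/2, 1/2, 1/2, 1, 1, 1/2, 1/2, 1/2] : Fin 15 → ℝ) p) ∧ StrictAnti t} ∧ Set.EqOn (I p w).integrand (fun t => ∏ i, 1 / (t i - (![![0, 1, 2], ![0, 1, -1], ![0, 1, 2], ![0, 1, -1], ![0, 1, 2], ![0, 1, 2], ![0, 1, 2], ![0, 1, 2], ![0, 1, 2], ![0, 1, 2], ![0, -1, 2], ![0, -1, 2], ![0, 1, 2], ![0, 1, 2], ![0, 1, 2]]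 : Fin 15 → Fin 3 → ℝ) p (w.get i))) (I p w).domain := by
  sorry

/-- **Stub `stub_shuffleProduct`** [M]: SHUFFLE = DISSECTION for the path simplices, at the
level of classes: for two words `u, v` not ending in the letter `0`, the Fubini product of the two
simplex representations minus the sum of the representations of the shuffled words lies in
`KZ.relations` (the product `Δ_u × Δ_v` is, up to the null tie-walls, the disjoint union over the
interleavings `w ∈ u ш v` of cells that are coordinate permutations of the simplex `Δ_w`, with the
interleaved integrand: moves (1a) domain additivity, (2) `KZ.of_sub_of_reindex_mem_relations`, and
`KZ.of_mem_relations_of_volume_eq_zero` for the walls). [cite: Eie2013, §1.2] -/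
theorem stub_shuffleProduct :
    ∀ (I : (p : Fin 15) → (w : List (Fin 3)) → KZ.IntegralRep w.length), (∀ (p : Fin 15) (w : List (Fin 3)), w.getLast? ≠ some 0 → (I p w).domain = {t | (∀ i, 0 < t i ∧ t i < (![1/2, 1/2, 1/2, 1/2, 1/2, 1/2, 1/2, 1/2, 1/2, 1/2, 1, 1, 1/2, 1/2, 1/2] : Fin 15 → ℝ) p) ∧ StrictAnti t} ∧ Set.EqOn (I p w).integrand (fun t => ∏ i, 1 / (t i - (![![0, 1, 2], ![0, 1, -1], ![0, 1, 2], ![0, 1, -1], ![0, 1, 2], ![0, 1, 2], ![0, 1, 2], ![0, 1, 2], ![0, 1, 2], ![0, 1, 2], ![0, -1, 2], ![0, -1, 2], ![0, 1, 2], ![0, 1, 2], ![0, 1, 2]] : Fin 15 → Fin 3 → ℝ) p (w.get i))) (I p w).domain) → (∀ (p : Fin 15) (u v : List (Fin 3)), u.getLast? ≠ some 0 → v.getLast? ≠ some 0 → KZ.of (I p u) * KZ.of (I p v) - ((MZV.shuffleWord u v).map (fun w => KZ.of (I p w))).sum ∈ KZ.relations) := by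
  sorry

/-- **Stub `stub_groupLike`** [M]: the LOG-FREE TRANSPORTS ARE GROUP-LIKE. Given the
class-level shuffle product of `stub_shuffleProduct`, every realisation `χ` of the rules turns the
end-regularised series `P p W = ⟨χ[I p ·], regEnd₀ W⟩` into a group-like series over `R`
(the end regularisation `regEnd₀ = Σ_k (-1)^k 0^k ш (· minus its last k letters)` is a
homomorphism of shuffle algebras onto the words not ending in `0`, IKZ 2006 Prop. 1 / Cor. 5 in
mirror image, cf. `ShuffleAlgebra.endSystem`, `TaylorSystem.taylor_mul`; and `χ` is multiplicative
and kills `KZ.relations`). [cite: IharaKanekoZagier2006, §2 Prop. 1] -/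
theorem stub_groupLike :
    ∀ (R : Type) [CommRing R] [Algebra ℚ R] (χ : KZ.FormalRep →+ R), (∀ c ∈ KZ.relations, χ c = 0) → (∀ x y : KZ.FormalRep, χ (x * y) = χ x * χ y) → (∃ u : KZ.FormalRep, χ u = 1) → ∀ (I : (p : Fin 15) → (w : List (Fin 3)) → KZ.IntegralRep w.length), (∀ (p : Fin 15) (w : List (Fin 3)), w.getLast? ≠ some 0 → (I p w).domain = {t | (∀ i, 0 < t i ∧ t i < (![1/2, 1/2, 1/2, 1/2, 1/2, 1/2, 1/2, 1/2, 1/2, 1/2, 1, 1, 1/2, 1/2, 1/2] : Fin 15 → ℝ) p) ∧ StrictAnti t} ∧ Set.EqOn (I p w).integrand (fun t => ∏ i, 1 / (t i - (![![0, 1, 2], ![0, 1, -1], ![0, 1, 2], ![0, 1, -1], ![0, 1, 2], ![0, 1, 2], ![0, 1, 2], ![0, 1, 2], ![0, 1, 2], ![0, 1, 2], ![0, -1, 2], ![0, -1, 2], ![0, 1, 2], ![0, 1, 2], ![0, 1, 2]] : Fin 15 → Fin 3 → ℝ) p (w.get i))) (I p w).domain) → (∀ (p : Fin 15) (u v : List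 (Fin 3)), u.getLast? ≠ some 0 → v.getLast? ≠ some 0 → KZ.of (I p u) * KZ.of (I p v) - ((MZV.shuffleWord u v).map (fun w => KZ.of (I p w))).sum ∈ KZ.relations) → ∀ (P : Fin 15 → NCSeries (Fin 3) R), (∀ (p : Fin 15) (W : List (Fin 3)), P p W = if W = [] then 1 else Shuffle.pair (fun w => χ (KZ.of (I p w))) (Shuffle.regEnd 0 W)) → (∀ p : Fin 15, NCSeries.IsGroupLike (P p)) := by
  sorry

/-- **Stub `stub_halfEdgeUniversal`** [L]: the UNIVERSAL HALF-EDGE IDENTITY. With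
`A(X,Y) := (P 5)(X, Y, 0)` the log-free transport of `X dt/t + Y dt/(t-1)` over `(0, ½)` from the
tangential base point at `0`, `λ := χ[∫₀^{1/2} dt/(t-1)] = [log ½]` and `Φ_χ` the crux series:
`A(Y,X) · e^{λY} · Φ_χ(X,Y) = A(X,Y) · e^{λX}` for all weight-one `X, Y` — the class-level form of
`Φ_KZ = G₁(½)⁻¹ G₀(½)` (composition of the two tangential half-transports at the midpoint
`t = ½`: dissection of the MZV simplex `1 > t₁ > ⋯ > t_n > 0` by the number of `tᵢ > ½`, Fubini,
the reflection `t ↦ 1 - t`, the antipode of the group-like `A`, and the regularisation algebra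
`Shuffle.factorisation` / `MZV.shuffleReg = regFront ∘ regEnd`). [cite: Drinfeld1991, §2] -/
theorem stub_halfEdgeUniversal :
    ∀ (R : Type) [CommRing R] [Algebra ℚ R] (χ : KZ.FormalRep →+ R), (∀ c ∈ KZ.relations, χ c = 0) → (∀ x y : KZ.FormalRep, χ (x * y) = χ x * χ y) → (∃ u : KZ.FormalRep, χ u = 1) → ∀ (Z : List ℕ → KZ.FormalRep), (∀ (u : List ℕ) (hu : MZV.IsAdmissible u), Z u = KZ.of (KZ.mzvRep u hu (KZ.mzvIntegrand_isSemialgebraicFunOn_holds u) (KZ.mzvIntegrand_integrableOn_holds u hu))) → ∀ (φ : NCSeries Bool R), (φ = fun W : List Bool => (-1 : R) ^ (W.count true) * (MZV.shuffleReg W).sum (fun v a => a • (if MZV.IsConvergentWord v then χ (Z (MZV.ofBinaryWord v)) else (0 : R)))) → ∀ (I : (p : Fin 15) → (w : List (Fin 3)) → KZ.IntegralRep w.length), (∀ (p : Fin 15) (w : List (Fin 3)), w.getLast? ≠ some 0 → (I p w).domain = {t | (∀ i, 0 < t i ∧ t i < (![1/2, 1/2, 1/2, 1/2, 1/2, 1/2,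 1/2, 1/2, 1/2, 1/2, 1, 1, 1/2, 1/2, 1/2] : Fin 15 → ℝ) p) ∧ StrictAnti t} ∧ Set.EqOn (I p w).integrand (fun t => ∏ i, 1 / (t i - (![![0, 1, 2], ![0, 1, -1], ![0, 1, 2], ![0, 1, -1], ![0, 1, 2], ![0, 1, 2], ![0, 1, 2], ![0, 1, 2], ![0, 1, 2], ![0, 1, 2], ![0, -1, 2], ![0, -1, 2], ![0, 1, 2], ![0, 1, 2], ![0, 1, 2]] : Fin 15 → Fin 3 → ℝ) p (w.get i))) (I p w).domain) → ∀ (P : Fin 15 → NCSeries (Fin 3) R), (∀ (p : Fin 15) (W : List (Fin 3)), P p W = if W = [] then 1 else Shuffle.pair (fun w => χ (KZ.of (I p w))) (Shuffle.regEnd 0 W)) → (∀ p : Fin 15, NCSeries.IsGroupLike (P p)) → ∀ (N : ℕ) (x y : DrinfeldKohnoTrunc R (Fin 4) N), x ∈ (DrinfeldKohnoTrunc.genSpan : Submodule R (DrinfeldKohnoTrunc R (Fin 4) N)) → y ∈ (DrinfeldKohnoTrunc.genSpan : Submodule R (DrinfeldKohnoTrunc R (Fin 4) N)) → NCSeries.evalTrunc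 N (![y, x, 0] : Fin 3 → DrinfeldKohnoTrunc R (Fin 4) N) (P 5) * truncExp R N (χ (KZ.of (I 5 [1])) • y) * NCSeries.subst₂ N φ x y = NCSeries.evalTrunc N (![x, y, 0] : Fin 3 → DrinfeldKohnoTrunc R (Fin 4) N) (P 5) * truncExp R N (χ (KZ.of (I 5 [1])) • x) := by
  sorry

/-- **Stub `stub_chartB`** [M]: the CHART IDENTITY between the two half-edge families. With
`B(X,W) := (P 10)(X, W, 0)` the log-free transport of `X ds/s + W ds/(s+1)` over `(0, 1)` from the
tangential base point at `0` (paths 10, 11: the edge `t₁₂ — t₂₃` read in the charts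
`s = τ/(1-τ)` centred at its two vertices, midpoint at `s = 1`): `B(X,W) = A(X, -X-W) · e^{λX}`
for all weight-one `X, W` — the change of variables `s = τ/(1-τ)` (`ds/s = dτ/τ - dτ/(τ-1)`,
`ds/(s+1) = -dτ/(τ-1)`, integrand additivity) on words not ending in `0`, extended to all words by
the end-regularisation algebra of the two group-like series (the factor `e^{λX}` is the change of
scale `log 1 = 0` versus `log ½` at the endpoint). [folklore] -/
theorem stub_chartB :
    ∀ (R : Type) [CommRing R] [Algebra ℚ R] (χ : KZ.FormalRep →+ R), (∀ c ∈ KZ.relations, χ c = 0) → (∀ x y : KZ.FormalRep, χ (x * y) = χ x * χ y) → (∃ u : KZ.FormalRep, χ u = 1) → ∀ (I : (p : Fin 15) → (w : List (Fin 3)) → KZ.IntegralRep w.length), (∀ (p : Fin 15) (w : List (Fin 3)), w.getLast? ≠ some 0 → (I p w).domain = {t | (∀ i, 0 < t i ∧ t i < (![1/2, 1/2, 1/2, 1/2, 1/2, 1/2, 1/2, 1/2, 1/2, 1/2, 1, 1, 1/2, 1/2, 1/2] : Fin 15 → ℝ) p) ∧ StrictAnti t} ∧ Set.EqOn (I p w).integrand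 (fun t => ∏ i, 1 / (t i - (![![0, 1, 2], ![0, 1, -1], ![0, 1, 2], ![0, 1, -1], ![0, 1, 2], ![0, 1, 2], ![0, 1, 2], ![0, 1, 2], ![0, 1, 2], ![0, 1, 2], ![0, -1, 2], ![0, -1, 2], ![0, 1, 2], ![0, 1, 2], ![0, 1, 2]] : Fin 15 → Fin 3 → ℝ) p (w.get i))) (I p w).domain) → ∀ (P : Fin 15 → NCSeries (Fin 3) R), (∀ (p : Fin 15) (W : List (Fin 3)), P p W = if W = [] then 1 else Shuffle.pair (fun w => χ (KZ.of (I p w))) (Shuffle.regEnd 0 W)) → (∀ p : Fin 15, NCSeries.IsGroupLike (P p)) → ∀ (N : ℕ) (x w : DrinfeldKohnoTrunc R (Fin 4) N), x ∈ (DrinfeldKohnoTrunc.genSpan : Submodule R (DrinfeldKohnoTrunc R (Fin 4) N)) → w ∈ (DrinfeldKohnoTrunc.genSpan : Submodule R (DrinfeldKohnoTrunc R (Fin 4) N)) → NCSeries.evalTrunc N (![x, w, 0] : Fin 3 → DrinfeldKohnoTrunc R (Fin 4) N) (P 10) = NCSeries.evalTrunc N (![x, -x - w, 0] : Fin 3 →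 DrinfeldKohnoTrunc R (Fin 4) N) (P 5) * truncExp R N (χ (KZ.of (I 5 [1])) • x) := by
  sorry

/-- **Stub `stub_logfreeCorners`** [XL, hardest]: the five LOG-FREE CORNER IDENTITIES at the
vertices of the closed pentagon cell (flatness on the kite vertex–midpoint–centre–midpoint, both
divisors through the vertex end-regularised), in every realisation of the rules.
[cite: Drinfeld1991, §2] -/
theorem stub_logfreeCorners :
    ∀ (R : Type) [CommRing R] [Algebra ℚ R] (χ : KZ.FormalRep →+ R), (∀ c ∈ KZ.relations, χ c = 0) → (∀ x y : KZ.FormalRep, χ (x * y) = χ x * χ y) → (∃ u : KZ.FormalRep, χ u = 1) → ∀ (I : (p : Fin 15) → (w : List (Fin 3)) → KZ.IntegralRep w.length), (∀ (p : Fin 15) (w : List (Fin 3)), w.getLast? ≠ some 0 → (I p w).domain = {t | (∀ i, 0 < t i ∧ t i < (![1/2, 1/2, 1/2, 1/2, 1/2, 1/2, 1/2, 1/2, 1/2, 1/2, 1, 1, 1/2, 1/2, 1/2] : Fin 15 → ℝ) p) ∧ StrictAnti t} ∧ Set.EqOn (I p w).integrand (fun t => ∏ i, 1 / (t i - (![![0,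 1, 2], ![0, 1, -1], ![0, 1, 2], ![0, 1, -1], ![0, 1, 2], ![0, 1, 2], ![0, 1, 2], ![0, 1, 2], ![0, 1, 2], ![0, 1, 2], ![0, -1, 2], ![0, -1, 2], ![0, 1, 2], ![0, 1, 2], ![0, 1, 2]] : Fin 15 → Fin 3 → ℝ) p (w.get i))) (I p w).domain) → ∀ (P : Fin 15 → NCSeries (Fin 3) R), (∀ (p : Fin 15) (W : List (Fin 3)), P p W = if W = [] then 1 else Shuffle.pair (fun w => χ (KZ.of (I p w))) (Shuffle.regEnd 0 W)) → ∀ (N : ℕ) (a b c d e : DrinfeldKohnoTrunc R (Fin 4) N), a = DrinfeldKohnoTrunc.t R N 0 1 → b = DrinfeldKohnoTrunc.t R N 0 2 → c = DrinfeldKohnoTrunc.t R N 1 2 → d = DrinfeldKohnoTrunc.t R N 1 3 → e = DrinfeldKohnoTrunc.t R N 2 3 → ∀ (M : Fin 15 → DrinfeldKohnoTrunc R (Fin 4) N), (∀ p : Fin 15, M p = NCSeries.evalTrunc N ((![![a + b + c, e, d], ![c, a, d], ![c + d + e, a + a + b + c, d], ![e, a + b + c, d], ![a, c, d], ![a, c,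 0], ![a + b + c, e, 0], ![c, a, 0], ![a + b + c, d + e, 0], ![c + d + e, a + b + c, 0], ![c, d, 0], ![e, d, 0], ![c + d + e, a, 0], ![a, c + d, 0], ![e, a + b + c, 0]] : Fin 15 → Fin 3 → DrinfeldKohnoTrunc R (Fin 4) N) p) (P p)) → M 0 * M 5 = M 4 * M 6 ∧ M 0 * M 7 = M 1 * M 8 ∧ M 2 * M 10 = M 1 * M 9 ∧ M 2 * M 11 = M 3 * M 12 ∧ M 4 * M 14 = M 3 * M 13 := by
  sorry

/-! ## 2. Algebra in the truncated Drinfeld–Kohno algebra -/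

section Algebra

variable {R : Type} [CommRing R] [Algebra ℚ R] {N : ℕ}

local notation "DK" => DrinfeldKohnoTrunc R (Fin 4) N

omit [Algebra ℚ R] in
/-- An element commuting with every value of the substitution commutes with the truncated
evaluation of any series. [folklore] -/
theorem commute_evalTrunc {α : Type} [Fintype α] {A : Type} [Ring A] [Algebra R A] {x : A}
    {v : α → A} (hv : ∀ i, Commute x (v i)) (n : ℕ) (S : NCSeries α R) :
    Commute x (NCSeries.evalTrunc n v S) := by
  unfold NCSeries.evalTrunc
  refine Commute.sum_right _ _ _ fun k _ => Commute.sum_right _ _ _ fun f _ => ?_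
  refine Commute.smul_right ?_ _
  exact Commute.list_prod_right _ _ fun y hy => by
    obtain ⟨i, -, rfl⟩ := List.mem_map.mp hy
    exact hv i

omit [Algebra ℚ R] in
/-- The truncated evaluation of a series with constant term `1` at weight-one values is a unit.
[folklore] -/
theorem isUnit_evalTrunc_of_mem {α : Type} [Fintype α] [DecidableEq α] {v : α → DK}
    (hv : ∀ i, v i ∈ (DrinfeldKohnoTrunc.genSpan : Submodule R DK)) {S : NCSeries α R}
    (hS : S [] = 1) : IsUnit (NCSeries.evalTrunc N v S) :=
  NCSeries.isUnit_evalTrunc N v (DrinfeldKohnoTrunc.prod_map_eq_zero_of_mem_genSpan v hv) hS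

/-- `e^{r x} e^{r y} = e^{r (x + y)}` for commuting weight-one `x, y`. [folklore] -/
theorem truncExp_smul_mul_truncExp_smul {x y : DK} (hxy : Commute x y)
    (hx : x ∈ (DrinfeldKohnoTrunc.genSpan : Submodule R DK))
    (hy : y ∈ (DrinfeldKohnoTrunc.genSpan : Submodule R DK)) (r : R) :
    truncExp R N (r • x) * truncExp R N (r • y) = truncExp R N (r • (x + y)) := by
  rw [smul_add, ← truncExp_add_of_commute N ((hxy.smul_left r).smul_right r)
    (DrinfeldKohnoTrunc.pow_eq_zero_of_mem_genSpan (Submodule.smul_mem _ _ hx))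
    (DrinfeldKohnoTrunc.pow_eq_zero_of_mem_genSpan (Submodule.smul_mem _ _ hy))
    (DrinfeldKohnoTrunc.pow_eq_zero_of_mem_genSpan
      (Submodule.add_mem _ (Submodule.smul_mem _ _ hx) (Submodule.smul_mem _ _ hy)))]

/-- `e^{r x}` is a unit for weight-one `x`. [folklore] -/
theorem isUnit_truncExp_smul {x : DK} (hx : x ∈ (DrinfeldKohnoTrunc.genSpan : Submodule R DK))
    (r : R) : IsUnit (truncExp R N (r • x)) :=
  have hn : (r • x) ^ (N + 1) = 0 :=
    DrinfeldKohnoTrunc.pow_eq_zero_of_mem_genSpan (Submodule.smul_mem _ _ hx)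
  ⟨⟨truncExp R N (r • x), truncExp R N (-(r • x)), truncExp_mul_truncExp_neg N hn,
    truncExp_neg_mul_truncExp N hn⟩, rfl⟩

/-- `e^{r x}` commutes with whatever `x` commutes with. [folklore] -/
theorem commute_truncExp_smul {x y : DK} (h : Commute x y) (r : R) :
    Commute (truncExp R N (r • x)) y :=
  (Commute.truncExp_right (h.symm.smul_right r) N).symm

/-! ### Central shifts of group-like three-letter series evaluated at `![x, y, 0]` -/

omit [Algebra ℚ R] in
/-- `![x + z, y, 0] = ![x, y, 0] + ![z, 0, 0]`. [folklore] -/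
theorem vec3_add_left {A : Type} [AddMonoid A] (x y z : A) :
    (![x + z, y, 0] : Fin 3 → A) = ![x, y, 0] + ![z, 0, 0] := by
  funext i; fin_cases i <;> simp

omit [Algebra ℚ R] in
/-- `![x, y + z, 0] = ![x, y, 0] + ![0, z, 0]`. [folklore] -/
theorem vec3_add_right {A : Type} [AddMonoid A] (x y z : A) :
    (![x, y + z, 0] : Fin 3 → A) = ![x, y, 0] + ![0, z, 0] := by
  funext i; fin_cases i <;> simp

omit [Algebra ℚ R] in
/-- The inner sum of `evalTrunc` at a substitution supported on ONE letter `ℓ` collapses to the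
power word `ℓⁿ`. [folklore] -/
theorem sum_fin_single_letter {A : Type} [Ring A] [Algebra R A] (S : NCSeries (Fin 3) R)
    (v : Fin 3 → A) (ℓ : Fin 3) (hv : ∀ i, i ≠ ℓ → v i = 0) (n : ℕ) :
    ∑ f : Fin n → Fin 3, S (List.ofFn f) • ((List.ofFn f).map v).prod =
      S (List.replicate n ℓ) • (v ℓ) ^ n := by
  rw [Finset.sum_eq_single_of_mem (fun _ => ℓ) (Finset.mem_univ _) ?_]
  · simp [List.ofFn_const, List.map_replicate, List.prod_replicate]
  · intro f _ hf
    have : ∃ i, f i ≠ ℓ := by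
      by_contra h
      push Not at h
      exact hf (funext h)
    obtain ⟨i, hi⟩ := this
    have h0 : ((List.ofFn f).map v).prod = 0 := by
      apply List.prod_eq_zero
      rw [List.mem_map]
      exact ⟨f i, by simp [List.mem_ofFn], hv _ hi⟩
    rw [h0, smul_zero]

/-- **Left shift evaluates to `1`**: `S(z, 0, 0) = 1` for a group-like `S` with `S(0) = 0`.
[folklore] -/
theorem evalTrunc_vec3_single₀ {S : NCSeries (Fin 3) R} (hS : NCSeries.IsGroupLike S)
    (h0 : S [0] = 0) (z : DK) : NCSeries.evalTrunc N (![z, 0, 0] : Fin 3 → DK) S = 1 := by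
  unfold NCSeries.evalTrunc
  rw [Finset.sum_eq_single_of_mem 0 (by simp) ?_]
  · simp [hS.1]
  · intro n _ hn
    rw [sum_fin_single_letter S _ 0 (fun i hi => by fin_cases i <;> simp_all)]
    rw [hS.apply_replicate_eq_zero h0 n hn, zero_smul]

/-- Coefficients of a group-like series on the powers of a letter: `S(ℓᵏ) = S(ℓ)ᵏ/k!`.
[cite: Reutenauer1993, Thm 3.2] -/
theorem IsGroupLike.apply_replicate {α : Type} [DecidableEq α] {S : NCSeries α R}
    (hS : NCSeries.IsGroupLike S) (ℓ : α) :
    ∀ k : ℕ, S (List.replicate k ℓ) = algebraMap ℚ R (1 / (k.factorial : ℚ)) * S [ℓ] ^ k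
  | 0 => by simp [hS.1]
  | k + 1 => by
    have h := hS.apply_singleton_mul_replicate ℓ k
    rw [IsGroupLike.apply_replicate hS ℓ k] at h
    have hinv : algebraMap ℚ R (1 / (k + 1 : ℚ)) * ((k + 1 : ℕ) : R) = 1 := by
      rw [← map_natCast (algebraMap ℚ R), ← map_mul, ← map_one (algebraMap ℚ R)]
      congr 1; push_cast; field_simp
    have hk : (k.factorial : ℚ) ≠ 0 := by positivity
    have hq : algebraMap ℚ R (1 / (k + 1 : ℚ)) * algebraMap ℚ R (1 / (k.factorial : ℚ)) =
        algebraMap ℚ R (1 / ((k + 1).factorial : ℚ)) := by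
      rw [← map_mul]; congr 1; rw [Nat.factorial_succ]; push_cast; field_simp
    calc S (List.replicate (k + 1) ℓ)
        = algebraMap ℚ R (1 / (k + 1 : ℚ)) * (((k + 1 : ℕ) : R) * S (List.replicate (k + 1) ℓ)) := by
          rw [← mul_assoc, hinv, one_mul]
      _ = algebraMap ℚ R (1 / (k + 1 : ℚ)) *
            (S [ℓ] * (algebraMap ℚ R (1 / (k.factorial : ℚ)) * S [ℓ] ^ k)) := by rw [h]
      _ = algebraMap ℚ R (1 / ((k + 1).factorial : ℚ)) * S [ℓ] ^ (k + 1) := by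
          rw [← hq]; ring

/-- **Right shift evaluates to an exponential**: `S(0, z, 0) = e^{S(1) z}` for a group-like `S`
and weight-one `z`. [cite: Reutenauer1993, Thm 3.2] -/
theorem evalTrunc_vec3_single₁ {S : NCSeries (Fin 3) R} (hS : NCSeries.IsGroupLike S) (z : DK) :
    NCSeries.evalTrunc N (![0, z, 0] : Fin 3 → DK) S = truncExp R N (S [1] • z) := by
  unfold NCSeries.evalTrunc truncExp
  refine Finset.sum_congr rfl fun n _ => ?_
  rw [sum_fin_single_letter S _ 1 (fun i hi => by fin_cases i <;> simp_all),
    IsGroupLike.apply_replicate hS 1 n, smul_pow, smul_smul]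
  simp

/-- **Left central shift** `S(x + z, y, 0) = S(x, y, 0)` for a group-like `S` with `S(0) = 0`,
`z` weight-one commuting with `x, y`. [cite: Furusho2010, Lemma 5 (proof)] -/
theorem evalTrunc_vec3_add_left {S : NCSeries (Fin 3) R} (hS : NCSeries.IsGroupLike S)
    (h0 : S [0] = 0) {x y z : DK} (hx : x ∈ (DrinfeldKohnoTrunc.genSpan : Submodule R DK))
    (hy : y ∈ (DrinfeldKohnoTrunc.genSpan : Submodule R DK))
    (hz : z ∈ (DrinfeldKohnoTrunc.genSpan : Submodule R DK)) (hzx : Commute z x) (hzy : Commute z y) :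
    NCSeries.evalTrunc N (![x + z, y, 0] : Fin 3 → DK) S =
      NCSeries.evalTrunc N (![x, y, 0] : Fin 3 → DK) S := by
  rw [vec3_add_left, hS.evalTrunc_add DrinfeldKohnoTrunc.genSpan
    DrinfeldKohnoTrunc.list_prod_eq_zero_of_mem_genSpan (v₁ := ![x, y, 0]) (v₂ := ![z, 0, 0])
    (fun i => by fin_cases i <;> simp [hx, hy]) (fun i => by fin_cases i <;> simp [hz])
    (fun i j => by fin_cases i <;> fin_cases j <;> simp [hzx.symm, hzy.symm]),
    evalTrunc_vec3_single₀ hS h0, mul_one]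

/-- **Right central shift** `S(x, y + z, 0) = S(x, y, 0) e^{S(1) z}` for a group-like `S`,
`z` weight-one commuting with `x, y`. [cite: Furusho2010, Lemma 5 (proof)] -/
theorem evalTrunc_vec3_add_right {S : NCSeries (Fin 3) R} (hS : NCSeries.IsGroupLike S)
    {x y z : DK} (hx : x ∈ (DrinfeldKohnoTrunc.genSpan : Submodule R DK))
    (hy : y ∈ (DrinfeldKohnoTrunc.genSpan : Submodule R DK))
    (hz : z ∈ (DrinfeldKohnoTrunc.genSpan : Submodule R DK)) (hzx : Commute z x) (hzy : Commute z y) :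
    NCSeries.evalTrunc N (![x, y + z, 0] : Fin 3 → DK) S =
      NCSeries.evalTrunc N (![x, y, 0] : Fin 3 → DK) S * truncExp R N (S [1] • z) := by
  rw [vec3_add_right, hS.evalTrunc_add DrinfeldKohnoTrunc.genSpan
    DrinfeldKohnoTrunc.list_prod_eq_zero_of_mem_genSpan (v₁ := ![x, y, 0]) (v₂ := ![0, z, 0])
    (fun i => by fin_cases i <;> simp [hx, hy]) (fun i => by fin_cases i <;> simp [hz])
    (fun i j => by fin_cases i <;> fin_cases j <;> simp [hzx.symm, hzy.symm]),
    evalTrunc_vec3_single₁ hS]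

/-! ### The two regularisation values used -/

omit [Algebra ℚ R] in
/-- `regEnd₀(0) = 0`: the end-regularised transports have no coefficient on the letter `0`.
[cite: IharaKanekoZagier2006, Cor. 5] -/
theorem regEnd_zero_singleton : Shuffle.regEnd (0 : Fin 3) [0] = 0 := by
  rw [Shuffle.regEnd]
  have : Shuffle.regFront (0 : Fin 3) [0] = 0 := by
    rw [Shuffle.regFront]
    have hl : Shuffle.leadCount (0 : Fin 3) [0] = 1 := by decide
    rw [hl, Finset.sum_range_succ, Finset.sum_range_succ, Finset.sum_range_zero]
    simp [Shuffle.shuffleSum, Shuffle.wordSum]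
  simp [this]

omit [Algebra ℚ R] in
/-- `regEnd₀(1) = 1` (a word not ending in `0` is untouched). [cite: IharaKanekoZagier2006, Cor. 5] -/
theorem regEnd_zero_singleton_one : Shuffle.regEnd (0 : Fin 3) [1] = Finsupp.single [1] 1 := by
  rw [Shuffle.regEnd, Shuffle.regFront]
  have hl : Shuffle.leadCount (0 : Fin 3) [1] = 0 := by decide
  rw [show ([1] : List (Fin 3)).reverse = [1] from rfl, hl, Finset.sum_range_succ, Finset.sum_range_zero]
  simp [Shuffle.shuffleSum, Shuffle.wordSum, MZV.shuffleWord]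

/-! ### Drinfeld's telescoping, abstract group form -/

/-- **The telescoping lemma** (abstract group form of Drinfeld's argument): in a group, five
"edge" elements given as `Φ₁ = (m₇ e_c)⁻¹ (m₅ e_a)`, …, whose half-transports satisfy the five
corner identities and commute with the five central shifts, satisfy the pentagon
`Φ₅ Φ₄ = Φ₃ Φ₂ Φ₁`. [cite: Drinfeld1991, §2] -/
theorem pentagon_of_corners_group {G : Type} [Group G]
    (m0 m1 m2 m3 m4 m5 m6 m7 m8 m9 m10 m11 m12 m13 m14 ea ec ee eabc ede ecd ecde : G)
    (c1 : m0 * m5 = m4 * m6) (c2 : m0 * m7 = m1 * m8) (c3 : m2 * m10 = m1 * m9)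
    (c4 : m2 * m11 = m3 * m12) (c5 : m4 * m14 = m3 * m13)
    -- exponential identities
    (x1 : ede * ec = ecde) (x2 : ee * ecd = ecde)
    -- commutations
    (k1 : eabc * ec = ec * eabc) (k2 : eabc * m7 = m7 * eabc) (k3 : eabc * m5 = m5 * eabc)
    (k4 : ec * m8 = m8 * ec) (k5 : ec * m9 = m9 * ec) (k6 : ec * ede = ede * ec)
    (k7 : ecde * m10 = m10 * ecde) (k8 : ecde * m11 = m11 * ecde)
    (k9 : ea * ee = ee * ea) (k10 : ea * m14 = m14 * ea) (k11 : ea * m6 = m6 * ea)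
    (k12 : ea * eabc = eabc * ea)
    (k13 : ee * m13 = m13 * ee) (k14 : ee * m12 = m12 * ee) (k15 : ee * ecd = ecd * ee) :
    ((m12 * ecd)⁻¹ * (m13 * ea)) * ((m14 * ee)⁻¹ * (m6 * eabc)) =
      (m11⁻¹ * m10) * (((m9 * ede)⁻¹ * (m8 * eabc)) * ((m7 * ec)⁻¹ * (m5 * ea))) := by
  -- right-hand side
  have hR : (m11⁻¹ * m10) * (((m9 * ede)⁻¹ * (m8 * eabc)) * ((m7 * ec)⁻¹ * (m5 * ea))) =
      ecde⁻¹ * (m12⁻¹ * (m3⁻¹ * (m4 * (m6 * (eabc * ea))))) := by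
    -- corner substitutions as solved equations
    have s2 : m8 * m7⁻¹ = m1⁻¹ * m0 := by
      rw [eq_inv_mul_iff_mul_eq, ← mul_inv_eq_iff_eq_mul.mpr c2.symm]; group
    have s3 : m10 * m9⁻¹ = m2⁻¹ * m1 := by
      rw [eq_inv_mul_iff_mul_eq, ← mul_inv_eq_iff_eq_mul.mpr c3.symm]; group
    have s41 : m11⁻¹ * m2⁻¹ * m0 * m5 = m12⁻¹ * m3⁻¹ * m4 * m6 := by
      have h1 : m11⁻¹ * m2⁻¹ = (m2 * m11)⁻¹ := by group
      have h2 : m12⁻¹ * m3⁻¹ = (m3 * m12)⁻¹ := by group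
      rw [h1, h2, c4, mul_assoc, mul_assoc, c1]
    -- commutations in inverse form
    have k2' : eabc * m7⁻¹ = m7⁻¹ * eabc := by
      rw [eq_comm, inv_mul_eq_iff_eq_mul, ← mul_assoc, ← k2]; group
    have k1' : eabc * ec⁻¹ = ec⁻¹ * eabc := by
      rw [eq_comm, inv_mul_eq_iff_eq_mul, ← mul_assoc, ← k1]; group
    have k5' : ec⁻¹ * m9⁻¹ = m9⁻¹ * ec⁻¹ := by
      have := congrArg (fun g => g⁻¹) k5; simp only [mul_inv_rev] at this; exact this.symm
    have k4' : ec⁻¹ * m8 = m8 * ec⁻¹ := by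
      rw [inv_mul_eq_iff_eq_mul, ← mul_assoc, k4]; group
    have k6' : ede⁻¹ * ec⁻¹ = ec⁻¹ * ede⁻¹ := by
      have := congrArg (fun g => g⁻¹) k6; simp only [mul_inv_rev] at this; exact this
    have k7' : ecde⁻¹ * m10 = m10 * ecde⁻¹ := by
      rw [inv_mul_eq_iff_eq_mul, ← mul_assoc, k7]; group
    have k8' : ecde⁻¹ * m11⁻¹ = m11⁻¹ * ecde⁻¹ := by
      have := congrArg (fun g => g⁻¹) k8; simp only [mul_inv_rev] at this; exact this.symm
    have hx1 : ede⁻¹ * ec⁻¹ = ecde⁻¹ := by rw [← x1, mul_inv_rev, k6']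
    calc (m11⁻¹ * m10) * (((m9 * ede)⁻¹ * (m8 * eabc)) * ((m7 * ec)⁻¹ * (m5 * ea)))
        = m11⁻¹ * m10 * ede⁻¹ * m9⁻¹ * m8 * (eabc * ec⁻¹) * m7⁻¹ * m5 * ea := by group
      _ = m11⁻¹ * m10 * ede⁻¹ * m9⁻¹ * m8 * ec⁻¹ * (eabc * m7⁻¹) * m5 * ea := by rw [k1']; group
      _ = m11⁻¹ * m10 * ede⁻¹ * m9⁻¹ * m8 * ec⁻¹ * m7⁻¹ * (eabc * m5) * ea := by rw [k2']; group
      _ = m11⁻¹ * m10 * ede⁻¹ * m9⁻¹ * (m8 * ec⁻¹) * m7⁻¹ * m5 * eabc * ea := by rw [k3]; group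
      _ = m11⁻¹ * m10 * ede⁻¹ * (m9⁻¹ * ec⁻¹) * m8 * m7⁻¹ * m5 * eabc * ea := by rw [← k4']; group
      _ = m11⁻¹ * m10 * (ede⁻¹ * ec⁻¹) * m9⁻¹ * m8 * m7⁻¹ * m5 * eabc * ea := by rw [← k5']; group
      _ = m11⁻¹ * (m10 * ecde⁻¹) * m9⁻¹ * m8 * m7⁻¹ * m5 * eabc * ea := by rw [hx1]; group
      _ = (m11⁻¹ * ecde⁻¹) * m10 * m9⁻¹ * m8 * m7⁻¹ * m5 * eabc * ea := by rw [← k7']; group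
      _ = ecde⁻¹ * m11⁻¹ * (m10 * m9⁻¹) * (m8 * m7⁻¹) * m5 * eabc * ea := by rw [← k8']; group
      _ = ecde⁻¹ * (m11⁻¹ * m2⁻¹ * m0 * m5) * eabc * ea := by rw [s3, s2]; group
      _ = ecde⁻¹ * (m12⁻¹ * (m3⁻¹ * (m4 * (m6 * (eabc * ea))))) := by rw [s41]; group
  -- left-hand side
  have hL : ((m12 * ecd)⁻¹ * (m13 * ea)) * ((m14 * ee)⁻¹ * (m6 * eabc)) =
      ecde⁻¹ * (m12⁻¹ * (m3⁻¹ * (m4 * (m6 * (eabc * ea))))) := by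
    have s5 : m13 * m14⁻¹ = m3⁻¹ * m4 := by
      rw [eq_inv_mul_iff_mul_eq, ← mul_inv_eq_iff_eq_mul.mpr c5.symm]; group
    have k9' : ea * ee⁻¹ = ee⁻¹ * ea := by
      rw [eq_comm, inv_mul_eq_iff_eq_mul, ← mul_assoc, ← k9]; group
    have k10' : ea * m14⁻¹ = m14⁻¹ * ea := by
      rw [eq_comm, inv_mul_eq_iff_eq_mul, ← mul_assoc, ← k10]; group
    have k13' : ee⁻¹ * m13 = m13 * ee⁻¹ := by
      rw [inv_mul_eq_iff_eq_mul, ← mul_assoc, k13]; group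
    have k14' : ee⁻¹ * m12⁻¹ = m12⁻¹ * ee⁻¹ := by
      have := congrArg (fun g => g⁻¹) k14; simp only [mul_inv_rev] at this; exact this.symm
    have k15' : ecd⁻¹ * ee⁻¹ = ee⁻¹ * ecd⁻¹ := by
      have := congrArg (fun g => g⁻¹) k15; simp only [mul_inv_rev] at this; exact this
    have hx2 : ecd⁻¹ * ee⁻¹ = ecde⁻¹ := by rw [← x2, mul_inv_rev]
    calc ((m12 * ecd)⁻¹ * (m13 * ea)) * ((m14 * ee)⁻¹ * (m6 * eabc))
        = ecd⁻¹ * m12⁻¹ * m13 * (ea * ee⁻¹) * m14⁻¹ * m6 * eabc := by group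
      _ = ecd⁻¹ * m12⁻¹ * m13 * ee⁻¹ * (ea * m14⁻¹) * m6 * eabc := by rw [k9']; group
      _ = ecd⁻¹ * m12⁻¹ * m13 * ee⁻¹ * m14⁻¹ * (ea * m6) * eabc := by rw [k10']; group
      _ = ecd⁻¹ * m12⁻¹ * m13 * ee⁻¹ * m14⁻¹ * m6 * (ea * eabc) := by rw [k11]; group
      _ = ecd⁻¹ * m12⁻¹ * (m13 * ee⁻¹) * m14⁻¹ * m6 * eabc * ea := by rw [k12]; group
      _ = ecd⁻¹ * (m12⁻¹ * ee⁻¹) * m13 * m14⁻¹ * m6 * eabc * ea := by rw [← k13']; group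
      _ = (ecd⁻¹ * ee⁻¹) * m12⁻¹ * (m13 * m14⁻¹) * m6 * eabc * ea := by rw [← k14']; group
      _ = ecde⁻¹ * m12⁻¹ * (m3⁻¹ * m4) * m6 * eabc * ea := by rw [hx2, s5]
      _ = ecde⁻¹ * (m12⁻¹ * (m3⁻¹ * (m4 * (m6 * (eabc * ea))))) := by group
  rw [hL, hR]

end Algebra

/-! ## 3. The composition: the crux from the stubs -/

set_option maxHeartbeats 800000 in
/-- **The line closes the crux**: the six registered stubs imply `PentagonInKZ` (half-edge
factorisations by central shifts and the exponential law, then Drinfeld's telescoping over every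
realisation). [cite: Drinfeld1991, §2] -/
theorem PentagonInKZ_of : PentagonInKZ := by
  intro R _ _ χ hrel hmul hunit Z hZ N
  classical
  obtain ⟨I, hI⟩ := stub_pathFamilies
  -- the log-free transports
  set P : Fin 15 → NCSeries (Fin 3) R := fun p W =>
    if W = [] then 1 else Shuffle.pair (fun w => χ (KZ.of (I p w))) (Shuffle.regEnd 0 W) with hPdef
  have hP : ∀ (p : Fin 15) (W : List (Fin 3)), P p W = if W = [] then 1 else
      Shuffle.pair (fun w => χ (KZ.of (I p w))) (Shuffle.regEnd 0 W) := fun _ _ => rfl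
  -- generators
  set a : DrinfeldKohnoTrunc R (Fin 4) N := DrinfeldKohnoTrunc.t R N 0 1 with ha
  set b : DrinfeldKohnoTrunc R (Fin 4) N := DrinfeldKohnoTrunc.t R N 0 2 with hb
  set c : DrinfeldKohnoTrunc R (Fin 4) N := DrinfeldKohnoTrunc.t R N 1 2 with hc
  set d : DrinfeldKohnoTrunc R (Fin 4) N := DrinfeldKohnoTrunc.t R N 1 3 with hd
  set e : DrinfeldKohnoTrunc R (Fin 4) N := DrinfeldKohnoTrunc.t R N 2 3 with he
  set args : Fin 15 → Fin 3 → DrinfeldKohnoTrunc R (Fin 4) N :=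
    ![![a + b + c, e, d], ![c, a, d], ![c + d + e, a + a + b + c, d], ![e, a + b + c, d], ![a, c, d],
      ![a, c, 0], ![a + b + c, e, 0], ![c, a, 0], ![a + b + c, d + e, 0], ![c + d + e, a + b + c, 0],
      ![c, d, 0], ![e, d, 0], ![c + d + e, a, 0], ![a, c + d, 0], ![e, a + b + c, 0]] with hargs
  set M : Fin 15 → DrinfeldKohnoTrunc R (Fin 4) N := fun p => NCSeries.evalTrunc N (args p) (P p)
    with hMdef
  have hM : ∀ p : Fin 15, M p = NCSeries.evalTrunc N (args p) (P p) := fun _ => rfl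
  set φ : NCSeries Bool R := fun W : List Bool => (-1 : R) ^ (W.count true) *
    (MZV.shuffleReg W).sum (fun v a => a • (if MZV.IsConvergentWord v then
      χ (Z (MZV.ofBinaryWord v)) else (0 : R))) with hφ
  set L : R := χ (KZ.of (I 5 [1])) with hL
  set E : DrinfeldKohnoTrunc R (Fin 4) N → DrinfeldKohnoTrunc R (Fin 4) N :=
    fun x => truncExp R N (L • x) with hEdef
  have hE : ∀ x, E x = truncExp R N (L • x) := fun _ => rfl
  -- the stubs
  obtain ⟨C1, C2, C3, C4, C5⟩ := stub_logfreeCorners R χ hrel hmul hunit I hI P hP N a b c d e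
    rfl rfl rfl rfl rfl M hM
  have hSh := stub_shuffleProduct I hI
  have hG : ∀ p : Fin 15, NCSeries.IsGroupLike (P p) := stub_groupLike R χ hrel hmul hunit I hI hSh P hP
  have hU := stub_halfEdgeUniversal R χ hrel hmul hunit Z hZ φ rfl I hI P hP hG N
  have hB := stub_chartB R χ hrel hmul hunit I hI P hP hG N
  -- weight-one memberships
  have ga : a ∈ (DrinfeldKohnoTrunc.genSpan : Submodule R (DrinfeldKohnoTrunc R (Fin 4) N)) :=
    DrinfeldKohnoTrunc.t_mem_genSpan 0 1
  have gb : b ∈ (DrinfeldKohnoTrunc.genSpan : Submodule R (DrinfeldKohnoTrunc R (Fin 4) N)) :=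
    DrinfeldKohnoTrunc.t_mem_genSpan 0 2
  have gc : c ∈ (DrinfeldKohnoTrunc.genSpan : Submodule R (DrinfeldKohnoTrunc R (Fin 4) N)) :=
    DrinfeldKohnoTrunc.t_mem_genSpan 1 2
  have gd : d ∈ (DrinfeldKohnoTrunc.genSpan : Submodule R (DrinfeldKohnoTrunc R (Fin 4) N)) :=
    DrinfeldKohnoTrunc.t_mem_genSpan 1 3
  have ge : e ∈ (DrinfeldKohnoTrunc.genSpan : Submodule R (DrinfeldKohnoTrunc R (Fin 4) N)) :=
    DrinfeldKohnoTrunc.t_mem_genSpan 2 3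
  have g0 : (0 : DrinfeldKohnoTrunc R (Fin 4) N) ∈
      (DrinfeldKohnoTrunc.genSpan : Submodule R (DrinfeldKohnoTrunc R (Fin 4) N)) :=
    Submodule.zero_mem _
  have gargs : ∀ (p : Fin 15) (i : Fin 3), args p i ∈
      (DrinfeldKohnoTrunc.genSpan : Submodule R (DrinfeldKohnoTrunc R (Fin 4) N)) := by
    intro p i
    fin_cases p <;> fin_cases i <;>
      simp only [hargs] <;>
      first
        | exact g0
        | repeat (first | exact ga | exact gb | exact gc | exact gd | exact ge
                        | refine Submodule.add_mem _ ?_ ?_)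
  have gabc : a + b + c ∈ (DrinfeldKohnoTrunc.genSpan : Submodule R (DrinfeldKohnoTrunc R (Fin 4) N)) :=
    Submodule.add_mem _ (Submodule.add_mem _ ga gb) gc
  have gab : a + b ∈ (DrinfeldKohnoTrunc.genSpan : Submodule R (DrinfeldKohnoTrunc R (Fin 4) N)) :=
    Submodule.add_mem _ ga gb
  have gbc : b + c ∈ (DrinfeldKohnoTrunc.genSpan : Submodule R (DrinfeldKohnoTrunc R (Fin 4) N)) :=
    Submodule.add_mem _ gb gc
  have gde : d + e ∈ (DrinfeldKohnoTrunc.genSpan : Submodule R (DrinfeldKohnoTrunc R (Fin 4) N)) :=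
    Submodule.add_mem _ gd ge
  have gcd : c + d ∈ (DrinfeldKohnoTrunc.genSpan : Submodule R (DrinfeldKohnoTrunc R (Fin 4) N)) :=
    Submodule.add_mem _ gc gd
  have gcde : c + d + e ∈ (DrinfeldKohnoTrunc.genSpan : Submodule R (DrinfeldKohnoTrunc R (Fin 4) N)) :=
    Submodule.add_mem _ gcd ge
  -- the infinitesimal braid relations used
  have Fc_ab : Commute c (a + b) := by
    have h := DrinfeldKohnoTrunc.t_mul_add (R := R) (N := N) (1 : Fin 4) 2 0 (by decide) (by decide)
      (by decide)
    rw [DrinfeldKohnoTrunc.t_symm 1 0, DrinfeldKohnoTrunc.t_symm 2 0] at h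
    exact h
  have Fc_de : Commute c (d + e) :=
    DrinfeldKohnoTrunc.t_mul_add (R := R) (N := N) (1 : Fin 4) 2 3 (by decide) (by decide) (by decide)
  have Fa_bc : Commute a (b + c) :=
    DrinfeldKohnoTrunc.t_mul_add (R := R) (N := N) (0 : Fin 4) 1 2 (by decide) (by decide) (by decide)
  have Fa_e : Commute a e :=
    DrinfeldKohnoTrunc.t_comm (R := R) (N := N) (0 : Fin 4) 1 2 3 (by decide) (by decide) (by decide)
      (by decide) (by decide) (by decide)
  have Fe_cd : Commute e (c + d) := by
    have h := DrinfeldKohnoTrunc.t_mul_add (R := R) (N := N) (2 : Fin 4) 3 1 (by decide) (by decide)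
      (by decide)
    rw [DrinfeldKohnoTrunc.t_symm 2 1, DrinfeldKohnoTrunc.t_symm 3 1] at h
    exact h
  have Fd_ce : Commute d (c + e) := by
    have h := DrinfeldKohnoTrunc.t_mul_add (R := R) (N := N) (1 : Fin 4) 3 2 (by decide) (by decide)
      (by decide)
    rw [DrinfeldKohnoTrunc.t_symm 3 2] at h
    exact h
  -- derived commutations of the five central shifts
  have Zabc_a : Commute (a + b + c) a := by
    rw [add_assoc]; exact ((Commute.refl a).add_left Fa_bc.symm)
  have Zabc_c : Commute (a + b + c) c := Fc_ab.symm.add_left (Commute.refl c)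
  have Zc_abc : Commute c (a + b + c) := Zabc_c.symm
  have Zc_de : Commute c (d + e) := Fc_de
  have Zc_cde : Commute c (c + d + e) := by
    rw [add_assoc]; exact (Commute.refl c).add_right Fc_de
  have Zcde_c : Commute (c + d + e) c := Zc_cde.symm
  have Zcde_d : Commute (c + d + e) d := by
    have : c + d + e = d + (c + e) := by abel
    rw [this]; exact (Commute.refl d).add_left Fd_ce.symm
  have Zcde_e : Commute (c + d + e) e := Fe_cd.symm.add_left (Commute.refl e)
  have Za_e : Commute a e := Fa_e
  have Za_abc : Commute a (a + b + c) := Zabc_a.symm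
  have Ze_a : Commute e a := Fa_e.symm
  have Ze_cd : Commute e (c + d) := Fe_cd
  have Ze_cde : Commute e (c + d + e) := Zcde_e.symm
  have Zany_0 : ∀ x : DrinfeldKohnoTrunc R (Fin 4) N, Commute x 0 := fun x => Commute.zero_right x
  -- exponential identities and commutations
  have KE : ∀ x y : DrinfeldKohnoTrunc R (Fin 4) N, Commute x y → E x * E y = E y * E x :=
    fun x y h => by
      rw [hE, hE]; exact (commute_truncExp_smul (Commute.truncExp_right (h.smul_right L) N) L).eq
  have EE : ∀ x y : DrinfeldKohnoTrunc R (Fin 4) N, Commute x y →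
      x ∈ (DrinfeldKohnoTrunc.genSpan : Submodule R (DrinfeldKohnoTrunc R (Fin 4) N)) →
      y ∈ (DrinfeldKohnoTrunc.genSpan : Submodule R (DrinfeldKohnoTrunc R (Fin 4) N)) →
      E x * E y = E (x + y) := fun x y h hx hy => by
    rw [hE, hE, hE]; exact truncExp_smul_mul_truncExp_smul h hx hy L
  /- ### Part (i): the five half-edge factorisations from the universal stubs -/
  -- identification of paths with the same chart data
  have P_eq_of_chart : ∀ p q : Fin 15,
      (∀ w : List (Fin 3), w.getLast? ≠ some 0 → (I p w).domain = (I q w).domain) →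
      (∀ w : List (Fin 3), w.getLast? ≠ some 0 →
        Set.EqOn (I p w).integrand (I q w).integrand (I p w).domain) → P p = P q := by
    intro p q hdom hint
    funext W
    rw [hP, hP]
    split_ifs with hW
    · rfl
    · refine Shuffle.pair_congr fun v hv => ?_
      have hv0 : v.getLast? ≠ some 0 := Shuffle.getLast?_ne_of_mem_support_regEnd 0 W hv
      have hrel' : KZ.of (I q v) - KZ.of (I p v) ∈ KZ.relations :=
        KZ.of_sub_of_mem_relations_of_eqOn (hdom v hv0)
          (fun t ht => (hint v hv0 (by rw [hdom v hv0]; exact ht)).symm)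
      have := hrel _ hrel'
      rw [map_sub, sub_eq_zero] at this
      exact this.symm
  have chartA : ∀ p : Fin 15, p = 6 ∨ p = 7 ∨ p = 8 ∨ p = 9 ∨ p = 12 ∨ p = 13 ∨ p = 14 → P p = P 5 := by
    intro p hp
    refine P_eq_of_chart p 5 (fun w hw => ?_) (fun w hw => ?_)
    · rw [(hI p w hw).1, (hI 5 w hw).1]
      rcases hp with rfl | rfl | rfl | rfl | rfl | rfl | rfl <;> rfl
    · intro t ht
      have ht5 : t ∈ (I 5 w).domain := by
        rw [(hI 5 w hw).1]; rw [(hI p w hw).1] at ht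
        rcases hp with rfl | rfl | rfl | rfl | rfl | rfl | rfl <;> exact ht
      rw [(hI p w hw).2 ht, (hI 5 w hw).2 ht5]
      rcases hp with rfl | rfl | rfl | rfl | rfl | rfl | rfl <;> rfl
  have chartB11 : P 11 = P 10 := by
    refine P_eq_of_chart 11 10 (fun w hw => ?_) (fun w hw => ?_)
    · rw [(hI 11 w hw).1, (hI 10 w hw).1]; rfl
    · intro t ht
      have ht10 : t ∈ (I 10 w).domain := by
        rw [(hI 10 w hw).1]; rw [(hI 11 w hw).1] at ht; exact ht
      rw [(hI 11 w hw).2 ht, (hI 10 w hw).2 ht10]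
      rfl
  -- the two-letter evaluations
  set A : DrinfeldKohnoTrunc R (Fin 4) N → DrinfeldKohnoTrunc R (Fin 4) N → DrinfeldKohnoTrunc R (Fin 4) N :=
    fun x y => NCSeries.evalTrunc N (![x, y, 0] : Fin 3 → DrinfeldKohnoTrunc R (Fin 4) N) (P 5) with hAdef
  set Bf : DrinfeldKohnoTrunc R (Fin 4) N → DrinfeldKohnoTrunc R (Fin 4) N → DrinfeldKohnoTrunc R (Fin 4) N :=
    fun x w => NCSeries.evalTrunc N (![x, w, 0] : Fin 3 → DrinfeldKohnoTrunc R (Fin 4) N) (P 10) with hBdef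
  have m5 : M 5 = A a c := rfl
  have m7 : M 7 = A c a := by rw [hM, chartA 7 (by decide)]; rfl
  have m8 : M 8 = A (a + b + c) (d + e) := by rw [hM, chartA 8 (by decide)]; rfl
  have m9 : M 9 = A (c + d + e) (a + b + c) := by rw [hM, chartA 9 (by decide)]; rfl
  have m6 : M 6 = A (a + b + c) e := by rw [hM, chartA 6 (by decide)]; rfl
  have m14 : M 14 = A e (a + b + c) := by rw [hM, chartA 14 (by decide)]; rfl
  have m12 : M 12 = A (c + d + e) a := by rw [hM, chartA 12 (by decide)]; rfl
  have m13 : M 13 = A a (c + d) := by rw [hM, chartA 13 (by decide)]; rfl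
  have m10 : M 10 = Bf c d := rfl
  have m11 : M 11 = Bf e d := by rw [hM, chartB11]; rfl
  -- coefficients of `P 5` on the letters
  have hP5_0 : P 5 [0] = 0 := by
    rw [hP, if_neg (List.cons_ne_nil _ _), regEnd_zero_singleton, Shuffle.pair_zero]
  have hP5_1 : P 5 [1] = L := by
    rw [hP, if_neg (List.cons_ne_nil _ _), regEnd_zero_singleton_one, Shuffle.pair_single,
      one_smul]
  -- central shifts for `A`
  have SL : ∀ {x y z : DrinfeldKohnoTrunc R (Fin 4) N},
      x ∈ (DrinfeldKohnoTrunc.genSpan : Submodule R (DrinfeldKohnoTrunc R (Fin 4) N)) →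
      y ∈ (DrinfeldKohnoTrunc.genSpan : Submodule R (DrinfeldKohnoTrunc R (Fin 4) N)) →
      z ∈ (DrinfeldKohnoTrunc.genSpan : Submodule R (DrinfeldKohnoTrunc R (Fin 4) N)) →
      Commute z x → Commute z y → A (x + z) y = A x y :=
    fun hx hy hz hzx hzy => evalTrunc_vec3_add_left (hG 5) hP5_0 hx hy hz hzx hzy
  have SR : ∀ {x y z : DrinfeldKohnoTrunc R (Fin 4) N},
      x ∈ (DrinfeldKohnoTrunc.genSpan : Submodule R (DrinfeldKohnoTrunc R (Fin 4) N)) →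
      y ∈ (DrinfeldKohnoTrunc.genSpan : Submodule R (DrinfeldKohnoTrunc R (Fin 4) N)) →
      z ∈ (DrinfeldKohnoTrunc.genSpan : Submodule R (DrinfeldKohnoTrunc R (Fin 4) N)) →
      Commute z x → Commute z y → A x (y + z) = A x y * E z := by
    intro x y z hx hy hz hzx hzy
    rw [hE, ← hP5_1]
    exact evalTrunc_vec3_add_right (hG 5) hx hy hz hzx hzy
  -- the universal identity, instantiated
  have U : ∀ x y : DrinfeldKohnoTrunc R (Fin 4) N,
      x ∈ (DrinfeldKohnoTrunc.genSpan : Submodule R (DrinfeldKohnoTrunc R (Fin 4) N)) →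
      y ∈ (DrinfeldKohnoTrunc.genSpan : Submodule R (DrinfeldKohnoTrunc R (Fin 4) N)) →
      A y x * E y * NCSeries.subst₂ N φ x y = A x y * E x := fun x y hx hy => hU x y hx hy
  -- commutation of `E z` with `Φ(x,y)` and with `A`-values is only needed through `z` central:
  have KΦ : ∀ {z x y : DrinfeldKohnoTrunc R (Fin 4) N}, Commute z x → Commute z y →
      E z * NCSeries.subst₂ N φ x y = NCSeries.subst₂ N φ x y * E z := fun hzx hzy => by
    rw [hE]
    exact (commute_truncExp_smul (NCSeries.commute_evalTrunc_bsub hzx hzy N φ) L).eq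
  have KA : ∀ {z x y : DrinfeldKohnoTrunc R (Fin 4) N}, Commute z x → Commute z y →
      E z * A x y = A x y * E z := fun {z x y} hzx hzy => by
    rw [hE]
    refine (commute_truncExp_smul (commute_evalTrunc (fun i => ?_) N (P 5)) L).eq
    fin_cases i
    · exact hzx
    · exact hzy
    · exact Commute.zero_right _
  -- H1 (edge 1): directly the universal identity at (a, c)
  have H1 : M 7 * E c * NCSeries.subst₂ N φ a c = M 5 * E a := by
    rw [m7, m5]; exact U a c ga gc
  -- H2 (edge 2): universal identity at (a+b, d+e), shifts by z₂ = c
  have H2 : M 9 * E (d + e) * NCSeries.subst₂ N φ (a + b) (d + e) = M 8 * E (a + b + c) := by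
    have h9 : M 9 = A (d + e) (a + b) * E c := by
      rw [m9, show c + d + e = (d + e) + c by abel, SL gde gabc gc Fc_de Zc_abc, SR gde gab gc Fc_de Fc_ab]
    have h8 : M 8 = A (a + b) (d + e) := by rw [m8, SL gab gde gc Fc_ab Fc_de]
    rw [h9, h8, ← EE (a + b) c Fc_ab.symm gab gc]
    have k1 : E c * E (d + e) = E (d + e) * E c := KE _ _ Fc_de
    have k2 : E c * NCSeries.subst₂ N φ (a + b) (d + e) = NCSeries.subst₂ N φ (a + b) (d + e) * E c :=
      KΦ Fc_ab Fc_de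
    calc A (d + e) (a + b) * E c * E (d + e) * NCSeries.subst₂ N φ (a + b) (d + e)
        = A (d + e) (a + b) * E (d + e) * NCSeries.subst₂ N φ (a + b) (d + e) * E c := by
          rw [mul_assoc (A _ _), k1, ← mul_assoc, mul_assoc _ (E c), k2, ← mul_assoc]
      _ = A (a + b) (d + e) * (E (a + b) * E c) := by rw [U (a + b) (d + e) gab gde, mul_assoc]
  -- H3 (edge 3): chart identity, shifts by -z₃, universal identity at (c, e)
  have H3 : M 11 * NCSeries.subst₂ N φ c e = M 10 := by
    have gz : -(c + d + e) ∈ (DrinfeldKohnoTrunc.genSpan : Submodule R (DrinfeldKohnoTrunc R (Fin 4) N)) :=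
      Submodule.neg_mem _ gcde
    have h10 : M 10 = A c e * E (-(c + d + e)) * E c := by
      rw [m10, hBdef]
      show NCSeries.evalTrunc N ![c, d, 0] (P 10) = _
      rw [hB c d gc gd, show -c - d = e + -(c + d + e) by abel]
      show A c (e + -(c + d + e)) * E c = _
      rw [SR gc ge gz Zcde_c.neg_left Zcde_e.neg_left]
    have h11 : M 11 = A e c * E (-(c + d + e)) * E e := by
      rw [m11, hBdef]
      show NCSeries.evalTrunc N ![e, d, 0] (P 10) = _
      rw [hB e d ge gd, show -e - d = c + -(c + d + e) by abel]
      show A e (c + -(c + d + e)) * E e = _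
      rw [SR ge gc gz Zcde_e.neg_left Zcde_c.neg_left]
    rw [h10, h11]
    have k1 : E (-(c + d + e)) * E e = E e * E (-(c + d + e)) := KE _ _ Zcde_e.neg_left
    have k2 : E (-(c + d + e)) * NCSeries.subst₂ N φ c e = NCSeries.subst₂ N φ c e * E (-(c + d + e)) :=
      KΦ Zcde_c.neg_left Zcde_e.neg_left
    have k3 : E (-(c + d + e)) * E c = E c * E (-(c + d + e)) := KE _ _ Zcde_c.neg_left
    calc A e c * E (-(c + d + e)) * E e * NCSeries.subst₂ N φ c e
        = A e c * E e * NCSeries.subst₂ N φ c e * E (-(c + d + e)) := by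
          rw [mul_assoc (A _ _), k1, ← mul_assoc, mul_assoc _ (E (-(c + d + e))), k2, ← mul_assoc]
      _ = A c e * E c * E (-(c + d + e)) := by rw [U c e gc ge]
      _ = A c e * E (-(c + d + e)) * E c := by rw [mul_assoc, ← k3, ← mul_assoc]
  -- H4 (edge 4): universal identity at (b+c, e), shifts by z₄ = a
  have H4 : M 14 * E e * NCSeries.subst₂ N φ (b + c) e = M 6 * E (a + b + c) := by
    have h14 : M 14 = A e (b + c) * E a := by
      rw [m14, show a + b + c = (b + c) + a by abel, SR ge gbc ga Fa_e Fa_bc]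
    have h6 : M 6 = A (b + c) e := by
      rw [m6, show a + b + c = (b + c) + a by abel, SL gbc ge ga Fa_bc Fa_e]
    rw [h14, h6, show a + b + c = (b + c) + a by abel, ← EE (b + c) a Fa_bc.symm gbc ga]
    have k1 : E a * E e = E e * E a := KE _ _ Fa_e
    have k2 : E a * NCSeries.subst₂ N φ (b + c) e = NCSeries.subst₂ N φ (b + c) e * E a := KΦ Fa_bc Fa_e
    calc A e (b + c) * E a * E e * NCSeries.subst₂ N φ (b + c) e
        = A e (b + c) * E e * NCSeries.subst₂ N φ (b + c) e * E a := by
          rw [mul_assoc (A _ _), k1, ← mul_assoc, mul_assoc _ (E a), k2, ← mul_assoc]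
      _ = A (b + c) e * (E (b + c) * E a) := by rw [U (b + c) e gbc ge, mul_assoc]
  -- H5 (edge 5): universal identity at (a, c+d), left shift by z₅ = e
  have H5 : M 12 * E (c + d) * NCSeries.subst₂ N φ a (c + d) = M 13 * E a := by
    have h12 : M 12 = A (c + d) a := by
      rw [m12, SL gcd ga ge Fe_cd Ze_a]
    rw [h12, m13]; exact U a (c + d) ga gcd
  /- ### Part (ii): Drinfeld's telescoping -/
  -- commutations of exponentials with transports
  have KM : ∀ (x : DrinfeldKohnoTrunc R (Fin 4) N) (p : Fin 15), (∀ i, Commute x (args p i)) →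
      E x * M p = M p * E x := fun x p hx => by
    rw [hE, hM]; exact (commute_truncExp_smul (commute_evalTrunc hx N (P p)) L).eq
  have k1 : E (a + b + c) * E c = E c * E (a + b + c) := KE _ _ Zabc_c
  have k2 : E (a + b + c) * M 7 = M 7 * E (a + b + c) := KM _ 7 (by
    intro i; fin_cases i
    · exact Zabc_c
    · exact Zabc_a
    · exact Zany_0 _)
  have k3 : E (a + b + c) * M 5 = M 5 * E (a + b + c) := KM _ 5 (by
    intro i; fin_cases i
    · exact Zabc_a
    · exact Zabc_c
    · exact Zany_0 _)
  have k4 : E c * M 8 = M 8 * E c := KM _ 8 (by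
    intro i; fin_cases i
    · exact Zc_abc
    · exact Zc_de
    · exact Zany_0 _)
  have k5 : E c * M 9 = M 9 * E c := KM _ 9 (by
    intro i; fin_cases i
    · exact Zc_cde
    · exact Zc_abc
    · exact Zany_0 _)
  have k6 : E c * E (d + e) = E (d + e) * E c := KE _ _ Zc_de
  have k7 : E (c + d + e) * M 10 = M 10 * E (c + d + e) := KM _ 10 (by
    intro i; fin_cases i
    · exact Zcde_c
    · exact Zcde_d
    · exact Zany_0 _)
  have k8 : E (c + d + e) * M 11 = M 11 * E (c + d + e) := KM _ 11 (by
    intro i; fin_cases i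
    · exact Zcde_e
    · exact Zcde_d
    · exact Zany_0 _)
  have k9 : E a * E e = E e * E a := KE _ _ Za_e
  have k10 : E a * M 14 = M 14 * E a := KM _ 14 (by
    intro i; fin_cases i
    · exact Za_e
    · exact Za_abc
    · exact Zany_0 _)
  have k11 : E a * M 6 = M 6 * E a := KM _ 6 (by
    intro i; fin_cases i
    · exact Za_abc
    · exact Za_e
    · exact Zany_0 _)
  have k12 : E a * E (a + b + c) = E (a + b + c) * E a := KE _ _ Za_abc
  have k13 : E e * M 13 = M 13 * E e := KM _ 13 (by
    intro i; fin_cases i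
    · exact Ze_a
    · exact Ze_cd
    · exact Zany_0 _)
  have k14 : E e * M 12 = M 12 * E e := KM _ 12 (by
    intro i; fin_cases i
    · exact Ze_cde
    · exact Ze_a
    · exact Zany_0 _)
  have k15 : E e * E (c + d) = E (c + d) * E e := KE _ _ Ze_cd
  have X1 : E (d + e) * E c = E (c + d + e) := by
    rw [EE _ _ Fc_de.symm gde gc]; congr 1; abel
  have X2 : E e * E (c + d) = E (c + d + e) := by
    rw [EE _ _ Fe_cd ge gcd]; congr 1; abel
  -- units
  have hPnil : ∀ p, P p [] = 1 := fun p => by rw [hP]; simp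
  have uM : ∀ p, IsUnit (M p) := fun p => isUnit_evalTrunc_of_mem (gargs p) (hPnil p)
  have uE : ∀ {x : DrinfeldKohnoTrunc R (Fin 4) N},
      x ∈ (DrinfeldKohnoTrunc.genSpan : Submodule R (DrinfeldKohnoTrunc R (Fin 4) N)) → IsUnit (E x) :=
    fun hx => by rw [hE]; exact isUnit_truncExp_smul hx L
  obtain ⟨m0, hm0⟩ := uM 0; obtain ⟨m1, hm1⟩ := uM 1; obtain ⟨m2, hm2⟩ := uM 2
  obtain ⟨m3, hm3⟩ := uM 3; obtain ⟨m4, hm4⟩ := uM 4; obtain ⟨m5, hm5⟩ := uM 5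
  obtain ⟨m6, hm6⟩ := uM 6; obtain ⟨m7, hm7⟩ := uM 7; obtain ⟨m8, hm8⟩ := uM 8
  obtain ⟨m9, hm9⟩ := uM 9; obtain ⟨m10, hm10⟩ := uM 10; obtain ⟨m11, hm11⟩ := uM 11
  obtain ⟨m12, hm12⟩ := uM 12; obtain ⟨m13, hm13⟩ := uM 13; obtain ⟨m14, hm14⟩ := uM 14
  obtain ⟨ea, hea⟩ := uE ga; obtain ⟨ec, hec⟩ := uE gc; obtain ⟨ee, hee⟩ := uE ge
  obtain ⟨eabc, heabc⟩ := uE gabc; obtain ⟨ede, hede⟩ := uE gde; obtain ⟨ecd, hecd⟩ := uE gcd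
  obtain ⟨ecde, hecde⟩ := uE gcde
  have T : ∀ {u v : (DrinfeldKohnoTrunc R (Fin 4) N)ˣ}, (u : DrinfeldKohnoTrunc R (Fin 4) N) = v → u = v :=
    fun h => Units.ext h
  have key := pentagon_of_corners_group m0 m1 m2 m3 m4 m5 m6 m7 m8 m9 m10 m11 m12 m13 m14
    ea ec ee eabc ede ecd ecde
    (T (by push_cast; rw [hm0, hm5, hm4, hm6]; exact C1))
    (T (by push_cast; rw [hm0, hm7, hm1, hm8]; exact C2))
    (T (by push_cast; rw [hm2, hm10, hm1, hm9]; exact C3))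
    (T (by push_cast; rw [hm2, hm11, hm3, hm12]; exact C4))
    (T (by push_cast; rw [hm4, hm14, hm3, hm13]; exact C5))
    (T (by push_cast; rw [hede, hec, hecde]; exact X1))
    (T (by push_cast; rw [hee, hecd, hecde]; exact X2))
    (T (by push_cast; rw [heabc, hec]; exact k1)) (T (by push_cast; rw [heabc, hm7]; exact k2))
    (T (by push_cast; rw [heabc, hm5]; exact k3)) (T (by push_cast; rw [hec, hm8]; exact k4))
    (T (by push_cast; rw [hec, hm9]; exact k5)) (T (by push_cast; rw [hec, hede]; exact k6))
    (T (by push_cast; rw [hecde, hm10]; exact k7)) (T (by push_cast; rw [hecde, hm11]; exact k8))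
    (T (by push_cast; rw [hea, hee]; exact k9)) (T (by push_cast; rw [hea, hm14]; exact k10))
    (T (by push_cast; rw [hea, hm6]; exact k11)) (T (by push_cast; rw [hea, heabc]; exact k12))
    (T (by push_cast; rw [hee, hm13]; exact k13)) (T (by push_cast; rw [hee, hm12]; exact k14))
    (T (by push_cast; rw [hee, hecd]; exact k15))
  have solve : ∀ {u : (DrinfeldKohnoTrunc R (Fin 4) N)ˣ} {X Y : DrinfeldKohnoTrunc R (Fin 4) N},
      (u : DrinfeldKohnoTrunc R (Fin 4) N) * X = Y → X = (↑u⁻¹ : DrinfeldKohnoTrunc R (Fin 4) N) * Y :=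
    fun {u X Y} h => by rw [← h, Units.inv_mul_cancel_left]
  have e1 : NCSeries.subst₂ N φ a c = ↑((m7 * ec)⁻¹ * (m5 * ea)) := by
    rw [Units.val_mul, Units.val_mul, hm5, hea]
    exact solve (by push_cast; rw [hm7, hec]; exact H1)
  have e2 : NCSeries.subst₂ N φ (a + b) (d + e) = ↑((m9 * ede)⁻¹ * (m8 * eabc)) := by
    rw [Units.val_mul, Units.val_mul, hm8, heabc]
    exact solve (by push_cast; rw [hm9, hede]; exact H2)
  have e3 : NCSeries.subst₂ N φ c e = ↑(m11⁻¹ * m10) := by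
    rw [Units.val_mul, hm10]
    exact solve (by rw [hm11]; exact H3)
  have e4 : NCSeries.subst₂ N φ (b + c) e = ↑((m14 * ee)⁻¹ * (m6 * eabc)) := by
    rw [Units.val_mul, Units.val_mul, hm6, heabc]
    exact solve (by push_cast; rw [hm14, hee]; exact H4)
  have e5 : NCSeries.subst₂ N φ a (c + d) = ↑((m12 * ecd)⁻¹ * (m13 * ea)) := by
    rw [Units.val_mul, Units.val_mul, hm13, hea]
    exact solve (by push_cast; rw [hm12, hecd]; exact H5)
  show NCSeries.subst₂ N φ a (c + d) * NCSeries.subst₂ N φ (b + c) e =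
    NCSeries.subst₂ N φ c e * NCSeries.subst₂ N φ (a + b) (d + e) * NCSeries.subst₂ N φ a c
  rw [e1, e2, e3, e4, e5, ← Units.val_mul, ← Units.val_mul, ← Units.val_mul, key]
  congr 1
  simp only [mul_assoc]

end Summit.KontsevichZagierPeriods.FurushoPentagon.PentagonInKZ
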